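import Summits.BirchSwinnertonDyer.BirchSwinnertonDyer.Theorems.LambdaTransportDoorAtTwoMatsunoClassSecondFixedPoint
import Summits.BirchSwinnertonDyer.BirchSwinnertonDyer.Theorems.LambdaTransportDoorAtTwoLayerTwoAlgebra
import Summits.BirchSwinnertonDyer.Rank1Residual.X1.LambdaSqueezeAlgebra
import HarnessLib

/-!
# Cell bsd-rank2 (p2 GEN 66, part B): `ν₂ = T² + 2T + 2` in `Λ₂ = ℤ₂⟦T⟧` — prime, `λ(ν₂) = 2`, `(ν₂) ∌ C s`; the local
# criterion `rank_{ℤ₂} X/ν₂X = 0 ⟺ ν₂ ∤ f_X`; and the `λ`-BUDGET: `ν_k = (1+T)^{2^{k−1}} + 1 ∤ g` whenever `λ(g) < 2^{k−1}`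

Cell-side file (cell bsd-rank2, HOME `run/shared/lean/pub/bsd-rank2/`, seat bsd-rank2-p2 GEN 66; memo `p2/g66/GEN66.md`;
namespace `Summit.BirchSwinnertonDyer.BirchSwinnertonDyer.Theorems.LambdaTransportDoorAtTwoNuTwoCriterion`). THEOREMS ONLY (no
definition, no named fact, no instance, no `sorry`); pure algebra of `Λ₂`, no elliptic curve. The `ν₂`-analogue of GEN 65 part B §1
(`…MatsunoClassSecondFixedPoint`: the same three facts for `T + 2`), consumed by the class file `…MatsunoClassTowerLaw`.

CONTENT. §1 `ν₂ = T² + 2T + 2 = Φ₄(1+T)` is the image of the DISTINGUISHED IRREDUCIBLE `T² + 2T + 2 ∈ ℤ₂[T]` (no root in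
`ℚ₂`, `padicTwo_nu_ne_zero`), hence PRIME in `Λ₂` (`Literature…span_coe_isPrime_of_dvd`); `λ(ν₂) = 2`; `ν₂ ∤ C s` (`s ≠ 0`).
§2 the `λ`-budget: `(1+T)^{2^m} + 1` is distinguished of degree `2^m` (even binomials, constant term `2`), so it divides no `g ≠ 0`
with `λ(g) < 2^m` — for `λ(g) ≤ 2`, `m ≥ 2`: no cyclotomic factor of layer `≥ 3` divides the characteristic series / the 2-adic
L-function (the `Λ`-form of Rohrlich's non-vanishing of `L(A, χ, 1)`, made EFFECTIVE on a `λ = 2` class). §3 `ℓ_{(ν₂)}(X) = 0 ⟹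
rank_{ℤ₂} X/ν₂X = 0` (Weierstrass division of an annihilator `s ∉ (ν₂)`: `s = qν₂ + (a + bT)`, `(a, b) ≠ 0`; on `ker ν₂(T) ⊂ ℚ₂ ⊗ X`
either `b = 0 ≠ a` or `T = −a/b` would be a root of `ν₂` in `ℚ₂`), and with `…ResidualShape` the criterion
`rank_{ℤ₂} X/ν₂X = 0 ⟺ ν₂ ∤ f_X` (`char X = (f_X)`); `ν₂ ∣ L ⟺ ν₂ ∣ L/2^{μ(L)}`.

B1 honesty (director-bsd 2026-08-27): algebra of `Λ₂` only; BSD is not touched; S0 does not move. PARTITION: none; TWIN (D-0056): n/a.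

References: L. Washington, GTM 83 (1997) §7.1 (Prop. 7.2 Weierstrass division, Thm. 7.3), §13.2 (Lemma 13.10, Prop. 13.8) [Washington1997];
R. Greenberg, LNM 1716 (1999) Thm. 1.2, §1 p. 65, §4 [GreenbergLNM1716]; D. Rohrlich, Invent. Math. 75 (1984) 409–423 (non-vanishing of
`L(E, χ, 1)` for almost all `χ` of `p`-power conductor) [Rohrlich1984]; N. Bourbaki, AC VII §4 no. 5 [BourbakiAC5to7].
-/

set_option linter.dupNamespace false

noncomputable section

open scoped Classical MatrixGroups ModularForm TensorProduct Polynomial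

open CongruenceSubgroup WeierstrassCurve Literature.NumberTheory.EllipticCurves
  Literature.NumberTheory.EllipticCurves.ModularForms Literature.NumberTheory.EllipticCurves.IwasawaAlgebra
  Literature.NumberTheory.EllipticCurves.Rank1Residual Literature.NumberTheory.EllipticCurves.Rank1Residual.Typed
  Literature.NumberTheory.EllipticCurves.Greenberg1999
  Summit.BirchSwinnertonDyer.Rank1Residual.X1.MuLambda Summit.BirchSwinnertonDyer.Rank1Residual.X1.MuPart
  Summit.BirchSwinnertonDyer.Rank1Residual.X1.ParitySqueeze
  Summit.BirchSwinnertonDyer.Rank2 Summit.BirchSwinnertonDyer.Rank2.LambdaTransportDoor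
  Summit.BirchSwinnertonDyer.BirchSwinnertonDyer.Theorems.LambdaTransportDoorAtTwoLayerOne
  Summit.BirchSwinnertonDyer.BirchSwinnertonDyer.Theorems.LambdaTransportDoorAtTwoLayerTwoAlgebra
  Summit.BirchSwinnertonDyer.BirchSwinnertonDyer.Theorems.LambdaTransportDoorAtTwoMatsunoClassSecondFixedPoint

universe u

namespace Summit.BirchSwinnertonDyer.BirchSwinnertonDyer.Theorems.LambdaTransportDoorAtTwoNuTwoCriterion

/-! ### §1. `ν₂ = T² + 2T + 2`: distinguished, prime in `Λ₂`, `λ(ν₂) = 2`, `(ν₂) ∌ C s` -/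

/-- `T² + 2T + 2 ∈ ℤ₂[T]` is a distinguished polynomial of degree `2` (monic, lower coefficients in `2ℤ₂`).
[cite: Washington1997, §7.1] -/
theorem isDistinguishedAt_nuTwoPoly :
    (Polynomial.C 1 * Polynomial.X ^ 2 + Polynomial.C 2 * Polynomial.X + Polynomial.C 2 : ℤ_[2][X]).IsDistinguishedAt
      (IsLocalRing.maximalIdeal ℤ_[2]) ∧
    (Polynomial.C 1 * Polynomial.X ^ 2 + Polynomial.C 2 * Polynomial.X + Polynomial.C 2 : ℤ_[2][X]).natDegree = 2 := by
  have hdeg : (Polynomial.C 1 * Polynomial.X ^ 2 + Polynomial.C 2 * Polynomial.X + Polynomial.C 2 : ℤ_[2][X]).natDegree = 2 :=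
    Polynomial.natDegree_quadratic one_ne_zero
  have hmonic : (Polynomial.C 1 * Polynomial.X ^ 2 + Polynomial.C 2 * Polynomial.X + Polynomial.C 2 : ℤ_[2][X]).Monic := by
    rw [Polynomial.Monic, Polynomial.leadingCoeff_quadratic one_ne_zero]
  have h2 : (2 : ℤ_[2]) ∈ IsLocalRing.maximalIdeal ℤ_[2] := by
    rw [PadicInt.maximalIdeal_eq_span_p, Ideal.mem_span_singleton, Nat.cast_ofNat]
  refine ⟨⟨⟨fun {n} hn ↦ ?_⟩, hmonic⟩, hdeg⟩
  rw [hdeg] at hn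
  interval_cases n
  · simpa [Polynomial.coeff_X_pow, Polynomial.coeff_X, Polynomial.coeff_C] using h2
  · simpa [Polynomial.coeff_X_pow, Polynomial.coeff_X, Polynomial.coeff_C] using h2

/-- The image of `T² + 2T + 2 ∈ ℤ₂[T]` in `Λ₂` is `ν₂ = T·T + 2T + 2`. [folklore] -/
theorem coe_nuTwoPoly :
    ((Polynomial.C 1 * Polynomial.X ^ 2 + Polynomial.C 2 * Polynomial.X + Polynomial.C 2 : ℤ_[2][X]) : IwasawaAlgebra 2) =
      PowerSeries.X * PowerSeries.X + PowerSeries.C (2 : ℤ_[2]) * PowerSeries.X + PowerSeries.C (2 : ℤ_[2]) := by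
  rw [Polynomial.coe_add, Polynomial.coe_add, Polynomial.coe_mul, Polynomial.coe_mul, Polynomial.coe_pow,
    Polynomial.coe_C, Polynomial.coe_C, Polynomial.coe_X, map_one, one_mul, pow_two]

/-- **`ν₂ = T² + 2T + 2` is a prime element of `Λ₂ = ℤ₂⟦T⟧`**: it is distinguished and irreducible in `ℤ₂[T]` (degree `2`, no root
in `ℤ₂` — none even in `ℚ₂`, `padicTwo_nu_ne_zero`), and `Λ₂/(ν₂) ≅ ℤ₂[T]/(ν₂)` by Weierstrass division.
[cite: Washington1997, §7.1 (Prop. 7.2), §13.2 (Lemma 13.10)] -/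
theorem prime_nu_two : Prime (PowerSeries.X * PowerSeries.X + PowerSeries.C (2 : ℤ_[2]) * PowerSeries.X +
    PowerSeries.C (2 : ℤ_[2]) : IwasawaAlgebra 2) := by
  obtain ⟨hf, hdeg⟩ := isDistinguishedAt_nuTwoPoly
  have hcoe := coe_nuTwoPoly
  set f : ℤ_[2][X] := Polynomial.C 1 * Polynomial.X ^ 2 + Polynomial.C 2 * Polynomial.X + Polynomial.C 2 with hfdef
  have hroots : f.roots = 0 := by
    refine Multiset.eq_zero_of_forall_notMem fun r hr ↦ ?_
    have h := (Polynomial.mem_roots hf.monic.ne_zero).mp hr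
    rw [Polynomial.IsRoot.def, hfdef] at h
    simp only [Polynomial.eval_add, Polynomial.eval_mul, Polynomial.eval_C, Polynomial.eval_X, Polynomial.eval_pow,
      one_mul] at h
    refine padicTwo_nu_ne_zero (algebraMap ℤ_[2] ℚ_[2] r) ?_
    have h' := congrArg (algebraMap ℤ_[2] ℚ_[2]) h
    rw [map_add, map_add, map_mul, map_pow, map_ofNat, map_zero] at h'
    linear_combination h'
  have hirr : Irreducible f :=
    (hf.monic.irreducible_iff_roots_eq_zero_of_degree_le_three (by rw [hdeg]) (by rw [hdeg]; norm_num)).mpr hroots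
  have hprime : Prime f := UniqueFactorizationMonoid.irreducible_iff_prime.mp hirr
  haveI := (Ideal.span_singleton_prime hprime.ne_zero).mpr hprime
  have hcoe0 : (f : IwasawaAlgebra 2) ≠ 0 := coe_ne_zero_of_isDistinguishedAt hf
  have hP : Prime (f : IwasawaAlgebra 2) :=
    (Ideal.span_singleton_prime hcoe0).mp (span_coe_isPrime_of_dvd hf (dvd_refl f))
  rwa [hcoe] at hP

/-- `λ(ν₂) = 2` (the Weierstrass degree of a distinguished polynomial is its degree). [cite: Washington1997, §7.1] -/
theorem lam_nu_two : lam (PowerSeries.X * PowerSeries.X + PowerSeries.C (2 : ℤ_[2]) * PowerSeries.X +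
    PowerSeries.C (2 : ℤ_[2]) : IwasawaAlgebra 2) = 2 := by
  obtain ⟨hf, hdeg⟩ := isDistinguishedAt_nuTwoPoly
  rw [← coe_nuTwoPoly, lam_coe_eq_natDegree hf, hdeg]

/-- `λ(C s) = 0` for a non-zero constant `s = u · 2^v ∈ ℤ₂`. [folklore] -/
theorem lam_C_eq_zero {s : ℤ_[2]} (hs : s ≠ 0) : lam (PowerSeries.C s : IwasawaAlgebra 2) = 0 := by
  have hu : IsUnit (PowerSeries.C ((PadicInt.unitCoeff hs : ℤ_[2])) : IwasawaAlgebra 2) :=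
    (PadicInt.unitCoeff hs).isUnit.map PowerSeries.C
  rw [PadicInt.unitCoeff_spec hs, map_mul, map_pow, mul_comm, ← map_pow, lam_C_pow_mul _ hu.ne_zero]
  exact lam_eq_zero_of_isUnit hu

/-- **`ν₂ ∤ C s` for `s ≠ 0`**: `λ(C s) = 0 < 2 = λ(ν₂)` and `λ` is additive. [cite: Washington1997, §7.1] -/
theorem not_nu_two_dvd_C {s : ℤ_[2]} (hs : s ≠ 0) :
    ¬ (PowerSeries.X * PowerSeries.X + PowerSeries.C (2 : ℤ_[2]) * PowerSeries.X + PowerSeries.C (2 : ℤ_[2]) :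
      IwasawaAlgebra 2) ∣ PowerSeries.C s := by
  rintro ⟨g, hg⟩
  have hC0 : (PowerSeries.C s : IwasawaAlgebra 2) ≠ 0 := fun h ↦ hs (by simpa using congrArg PowerSeries.constantCoeff h)
  have hg0 : g ≠ 0 := fun h0 ↦ hC0 (by rw [hg, h0, mul_zero])
  have h := congrArg lam hg
  rw [lam_C_eq_zero hs, lam_mul prime_nu_two.ne_zero hg0, lam_nu_two] at h
  omega

/-- `(ν₂) ∌ C s` for `s ≠ 0` (ideal form, the hypothesis of `…ResidualShape`). [cite: Washington1997, §13.2] -/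
theorem C_notMem_span_nu_two {s : ℤ_[2]} (hs : s ≠ 0) :
    (PowerSeries.C s : IwasawaAlgebra 2) ∉ Ideal.span {(PowerSeries.X * PowerSeries.X + PowerSeries.C (2 : ℤ_[2]) *
      PowerSeries.X + PowerSeries.C (2 : ℤ_[2]) : IwasawaAlgebra 2)} :=
  fun h ↦ not_nu_two_dvd_C hs (Ideal.mem_span_singleton.mp h)

/-- `ν₂ ∣ L ⟺ ν₂ ∣ L/2^{μ(L)}` (`ν₂` is prime and divides no non-zero constant). [cite: Washington1997, §7.1] -/
theorem nu_two_dvd_iff_dvd_pfree {L : IwasawaAlgebra 2} :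
    (PowerSeries.X * PowerSeries.X + PowerSeries.C (2 : ℤ_[2]) * PowerSeries.X + PowerSeries.C (2 : ℤ_[2]) :
      IwasawaAlgebra 2) ∣ L ↔
    (PowerSeries.X * PowerSeries.X + PowerSeries.C (2 : ℤ_[2]) * PowerSeries.X + PowerSeries.C (2 : ℤ_[2]) :
      IwasawaAlgebra 2) ∣ pfree L := by
  have hfac := eq_C_pow_mu_mul_pfree (p := 2) L
  refine ⟨fun h ↦ ?_, fun h ↦ by rw [hfac]; exact dvd_mul_of_dvd_right h _⟩
  rw [hfac] at h
  exact (prime_nu_two.dvd_or_dvd h).resolve_left (not_nu_two_dvd_C (pow_ne_zero _ (by norm_num)))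

/-! ### §2. The `λ`-budget: `ν^{(m)} = (1+T)^{2^m} + 1` is distinguished of degree `2^m`; `ν^{(m)} ∤ g` if `λ(g) < 2^m` -/

/-- `(T+1)^{2^m} + 1 ∈ ℤ₂[T]` is distinguished of degree `2^m`: the binomial coefficients `(2^m choose i)`, `0 < i < 2^m`, are even
and the constant term is `2`. [cite: Washington1997, §7.1, §13.2] -/
theorem isDistinguishedAt_X_add_one_pow_add_one (m : ℕ) :
    ((Polynomial.X + Polynomial.C 1) ^ (2 ^ m) + Polynomial.C 1 : ℤ_[2][X]).IsDistinguishedAt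
      (IsLocalRing.maximalIdeal ℤ_[2]) ∧
    ((Polynomial.X + Polynomial.C 1) ^ (2 ^ m) + Polynomial.C 1 : ℤ_[2][X]).natDegree = 2 ^ m := by
  have hpow : ((Polynomial.X + Polynomial.C 1) ^ (2 ^ m) : ℤ_[2][X]).Monic := (Polynomial.monic_X_add_C 1).pow _
  have hdegpow : ((Polynomial.X + Polynomial.C 1) ^ (2 ^ m) : ℤ_[2][X]).natDegree = 2 ^ m := by
    rw [(Polynomial.monic_X_add_C 1).natDegree_pow, Polynomial.natDegree_X_add_C, mul_one]
  have hlt : (Polynomial.C (1 : ℤ_[2])).degree < ((Polynomial.X + Polynomial.C 1) ^ (2 ^ m) : ℤ_[2][X]).degree := by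
    rw [Polynomial.degree_C one_ne_zero, Polynomial.degree_eq_natDegree hpow.ne_zero, hdegpow]
    exact_mod_cast Nat.two_pow_pos m
  have hmonic : ((Polynomial.X + Polynomial.C 1) ^ (2 ^ m) + Polynomial.C 1 : ℤ_[2][X]).Monic := hpow.add_of_left hlt
  have hdeg : ((Polynomial.X + Polynomial.C 1) ^ (2 ^ m) + Polynomial.C 1 : ℤ_[2][X]).natDegree = 2 ^ m := by
    rw [Polynomial.natDegree_add_eq_left_of_degree_lt hlt, hdegpow]
  have h2 : (2 : ℤ_[2]) ∈ IsLocalRing.maximalIdeal ℤ_[2] := by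
    rw [PadicInt.maximalIdeal_eq_span_p, Ideal.mem_span_singleton, Nat.cast_ofNat]
  refine ⟨⟨⟨fun {n} hn ↦ ?_⟩, hmonic⟩, hdeg⟩
  rw [hdeg] at hn
  rw [Polynomial.coeff_add, Polynomial.coeff_X_add_C_pow, one_pow, one_mul, Polynomial.coeff_C]
  by_cases hn0 : n = 0
  · subst hn0
    rw [Nat.choose_zero_right, Nat.cast_one, if_pos rfl, one_add_one_eq_two]
    exact h2
  · rw [if_neg hn0, add_zero]
    obtain ⟨c, hc⟩ := Nat.Prime.dvd_choose_pow Nat.prime_two hn0 hn.ne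
    rw [hc, Nat.cast_mul, Nat.cast_ofNat]
    exact Ideal.mul_mem_right _ _ h2

/-- The image of `(T+1)^{2^m} + 1` in `Λ₂` is `ν^{(m)} = (1+T)^{2^m} + 1`. [folklore] -/
theorem coe_X_add_one_pow_add_one (m : ℕ) :
    (((Polynomial.X + Polynomial.C 1) ^ (2 ^ m) + Polynomial.C 1 : ℤ_[2][X]) : IwasawaAlgebra 2) =
      (1 + PowerSeries.X) ^ (2 ^ m) + 1 := by
  rw [Polynomial.coe_add, Polynomial.coe_pow, Polynomial.coe_add, Polynomial.coe_X, Polynomial.coe_C, map_one,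
    add_comm PowerSeries.X 1]

/-- **`λ((1+T)^{2^m} + 1) = 2^m`.** [cite: Washington1997, §7.1] -/
theorem lam_one_add_X_pow_add_one (m : ℕ) : lam (((1 + PowerSeries.X) ^ (2 ^ m) + 1 : IwasawaAlgebra 2)) = 2 ^ m := by
  obtain ⟨hf, hdeg⟩ := isDistinguishedAt_X_add_one_pow_add_one m
  rw [← coe_X_add_one_pow_add_one, lam_coe_eq_natDegree hf, hdeg]

/-- **THE `λ`-BUDGET.** If `g ∈ Λ₂` is non-zero with `λ(g) < 2^m`, then `ν^{(m)} = (1+T)^{2^m} + 1 ∤ g` (`λ` is additive on non-zero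
elements and `λ(ν^{(m)}) = 2^m`). With `ν^{(m)} = Φ_{2^{m+1}}(1+T)` the factor of the layer `m + 1` of the cyclotomic `ℤ₂`-tower:
NO LAYER `≥ 3` FACTOR divides a `g` with `λ(g) ≤ 2` — the `Λ`-form of Rohrlich's theorem made effective on a `λ = 2` class.
[cite: Washington1997, §7.1, §13.2] [cite: Rohrlich1984, Thm. (p. 409)] -/
theorem not_one_add_X_pow_add_one_dvd_of_lam_lt {g : IwasawaAlgebra 2} (hg : g ≠ 0) {m : ℕ} (hl : lam g < 2 ^ m) :
    ¬ ((1 + PowerSeries.X) ^ (2 ^ m) + 1 : IwasawaAlgebra 2) ∣ g := by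
  rintro ⟨h, rfl⟩
  have hν0 : ((1 + PowerSeries.X) ^ (2 ^ m) + 1 : IwasawaAlgebra 2) ≠ 0 := by
    rw [← coe_X_add_one_pow_add_one]
    exact coe_ne_zero_of_isDistinguishedAt (isDistinguishedAt_X_add_one_pow_add_one m).1
  have hh : h ≠ 0 := fun h0 ↦ hg (by rw [h0, mul_zero])
  have hle := lam_le_lam_mul hν0 hh
  rw [lam_one_add_X_pow_add_one m] at hle
  omega

/-- `λ(g) ≤ 2 ⟹ ν_k = (1+T)^{2^{k−1}} + 1 ∤ g` for every `k ≥ 3` (`2 < 4 ≤ 2^{k−1}`). [cite: Washington1997, §13.2] -/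
theorem not_nu_dvd_of_lam_le_two {g : IwasawaAlgebra 2} (hg : g ≠ 0) (hl : lam g ≤ 2) {k : ℕ} (hk : 3 ≤ k) :
    ¬ ((1 + PowerSeries.X) ^ (2 ^ (k - 1)) + 1 : IwasawaAlgebra 2) ∣ g := by
  refine not_one_add_X_pow_add_one_dvd_of_lam_lt hg (lt_of_le_of_lt hl ?_)
  calc (2 : ℕ) < 2 ^ 2 := by norm_num
    _ ≤ 2 ^ (k - 1) := Nat.pow_le_pow_right (by norm_num) (by omega)

/-- `λ(g) ≤ 2 ⟹ ν₂ ∣ g` forces `λ(g) = 2` (budget exhausted: `λ(ν₂) = 2`). [cite: Washington1997, §7.1] -/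
theorem lam_eq_two_of_nu_two_dvd {g : IwasawaAlgebra 2} (hg : g ≠ 0) (hl : lam g ≤ 2)
    (hdvd : (PowerSeries.X * PowerSeries.X + PowerSeries.C (2 : ℤ_[2]) * PowerSeries.X + PowerSeries.C (2 : ℤ_[2]) :
      IwasawaAlgebra 2) ∣ g) : lam g = 2 := by
  obtain ⟨h, rfl⟩ := hdvd
  have hh : h ≠ 0 := fun h0 ↦ hg (by rw [h0, mul_zero])
  have hle := lam_le_lam_mul prime_nu_two.ne_zero hh
  rw [lam_nu_two] at hle
  omega

/-! ### §3. `ℓ_{(ν₂)}(X) = 0 ⟹ rank_{ℤ₂} X/ν₂X = 0`, and the criterion `rank_{ℤ₂} X/ν₂X = 0 ⟺ ν₂ ∤ f_X` -/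

section Module

variable {M : Type u} [AddCommGroup M] [Module (IwasawaAlgebra 2) M]

/-- **`ℓ_{(ν₂)}(X) = 0 ⟹ rank_{ℤ₂} X/ν₂X = 0`** for a f.g. torsion `Λ₂`-module `X`: `X_{(ν₂)} = 0` gives an annihilator `s ∉ (ν₂)`;
Weierstrass division `s = q·ν₂ + (bT + a)` (Mathlib `PowerSeries.eq_mul_weierstrassDiv_add_weierstrassMod`) with `(a, b) ≠ (0, 0)`; on
`W = ker ν₂(T) ⊂ V = ℚ₂ ⊗ X`, `bT + a = 0`: if `b = 0` then `a ≠ 0` kills `W`; if `b ≠ 0` then `T = −a/b` on `W` and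
`ν₂(−a/b) · w = ν₂(T) w = 0` with `ν₂(−a/b) ≠ 0` (`padicTwo_nu_ne_zero`). So `W = 0`. [cite: Washington1997, §7.1 (Prop. 7.2), §13.2]
[cite: GreenbergLNM1716, §1 p. 65] -/
theorem lambdaInvariant_quotient_nu_two_eq_zero_of_lengthAt_eq_zero [Module.Finite (IwasawaAlgebra 2) M]
    (hM : Module.IsTorsion (IwasawaAlgebra 2) M) (𝔭 : PrimeSpectrum (IwasawaAlgebra 2))
    (h𝔭 : 𝔭.asIdeal = Ideal.span {(PowerSeries.X * PowerSeries.X + PowerSeries.C (2 : ℤ_[2]) * PowerSeries.X +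
      PowerSeries.C (2 : ℤ_[2]) : IwasawaAlgebra 2)})
    (h0 : Module.lengthAt (IwasawaAlgebra 2) M 𝔭 = 0) :
    lambdaInvariant 2 (M ⧸ (Ideal.span {(PowerSeries.X * PowerSeries.X + PowerSeries.C (2 : ℤ_[2]) * PowerSeries.X +
      PowerSeries.C (2 : ℤ_[2]) : IwasawaAlgebra 2)} • (⊤ : Submodule (IwasawaAlgebra 2) M))) = 0 := by
  classical
  letI : Module ℤ_[2] M := Module.compHom M (algebraMap ℤ_[2] (IwasawaAlgebra 2))
  haveI : IsScalarTower ℤ_[2] (IwasawaAlgebra 2) M := IsScalarTower.of_compHom ℤ_[2] _ _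
  haveI : Module.Flat ℤ_[2] ℚ_[2] := IsLocalization.flat ℚ_[2] (nonZeroDivisors ℤ_[2])
  haveI : Module.Finite ℚ_[2] (ℚ_[2] ⊗[ℤ_[2]] M) := finite_baseChange_of_isTorsion 2 hM
  -- an annihilator outside `(ν₂)`
  have hsub : Subsingleton (LocalizedModule 𝔭.asIdeal.primeCompl M) :=
    Module.length_eq_zero_iff.mp (by rw [Module.lengthAt] at h0; exact h0)
  have hsupp : 𝔭 ∉ Module.support (IwasawaAlgebra 2) M := Module.notMem_support_iff.mpr hsub
  have hann : ¬ Module.annihilator (IwasawaAlgebra 2) M ≤ 𝔭.asIdeal :=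
    fun h ↦ hsupp (Module.mem_support_iff_of_finite.mpr h)
  obtain ⟨s, hs, hs𝔭⟩ := SetLike.not_le_iff_exists.mp hann
  have hsM : ∀ x : M, s • x = 0 := fun x ↦ Module.mem_annihilator.mp hs x
  set π : IwasawaAlgebra 2 := PowerSeries.X * PowerSeries.X + PowerSeries.C (2 : ℤ_[2]) * PowerSeries.X +
    PowerSeries.C (2 : ℤ_[2]) with hπ
  have hsdvd : ¬ π ∣ s := by
    rw [h𝔭, Ideal.mem_span_singleton] at hs𝔭; exact hs𝔭
  -- Weierstrass division by the distinguished `ν₂`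
  obtain ⟨hf, hdeg⟩ := isDistinguishedAt_nuTwoPoly
  have hcoe : ((Polynomial.C 1 * Polynomial.X ^ 2 + Polynomial.C 2 * Polynomial.X + Polynomial.C 2 : ℤ_[2][X]) :
      IwasawaAlgebra 2) = π := coe_nuTwoPoly
  have hcoeff : ∀ k, PowerSeries.coeff k (PowerSeries.map (IsLocalRing.residue ℤ_[2]) π) =
      IsLocalRing.residue ℤ_[2]
        ((Polynomial.C 1 * Polynomial.X ^ 2 + Polynomial.C 2 * Polynomial.X + Polynomial.C 2 : ℤ_[2][X]).coeff k) :=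
    fun k ↦ by rw [← hcoe, PowerSeries.coeff_map, Polynomial.coeff_coe]
  have hord : (PowerSeries.map (IsLocalRing.residue ℤ_[2]) π).order = (2 : ℕ) := by
    rw [PowerSeries.order_eq_nat]
    constructor
    · have hc2 := hf.monic.coeff_natDegree
      rw [hdeg] at hc2
      rw [hcoeff, hc2, map_one]; exact one_ne_zero
    · intro i hi
      rw [hcoeff, IsLocalRing.residue_eq_zero_iff]
      exact hf.mem (by rw [hdeg]; exact hi)
  have hπne : PowerSeries.map (IsLocalRing.residue ℤ_[2]) π ≠ 0 := fun h ↦ by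
    have h' := congrArg PowerSeries.order h
    exact ENat.coe_ne_top 2 (by rwa [hord, PowerSeries.order_zero] at h')
  set q : IwasawaAlgebra 2 := s /ʷ π with hq
  set r : ℤ_[2][X] := s %ʷ π with hr
  have hdiv : s = π * q + (r : PowerSeries ℤ_[2]) := PowerSeries.eq_mul_weierstrassDiv_add_weierstrassMod s hπne
  have hdegr : r.degree < ((2 : ℕ) : WithBot ℕ) := by
    have h1 := PowerSeries.degree_weierstrassMod_lt s π
    rwa [hord, ENat.toNat_coe] at h1
  have hrn : r.natDegree ≤ 1 := by
    by_cases hr0 : r = 0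
    · rw [hr0, Polynomial.natDegree_zero]; exact zero_le_one
    · have := (Polynomial.natDegree_lt_iff_degree_lt hr0).mpr hdegr; omega
  have hr_eq : r = Polynomial.C (r.coeff 1) * Polynomial.X + Polynomial.C (r.coeff 0) :=
    Polynomial.eq_X_add_C_of_natDegree_le_one hrn
  have hr0 : r ≠ 0 := fun h ↦ hsdvd ⟨q, by rw [hdiv, h, Polynomial.coe_zero, add_zero]⟩
  have hab : r.coeff 1 ≠ 0 ∨ r.coeff 0 ≠ 0 := by
    by_contra h
    rw [not_or, not_not, not_not] at h
    exact hr0 (by rw [hr_eq, h.1, h.2, map_zero, zero_mul, zero_add])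
  have hrcoe : (r : IwasawaAlgebra 2) = PowerSeries.C (r.coeff 1) * PowerSeries.X + PowerSeries.C (r.coeff 0) := by
    conv_lhs => rw [hr_eq]
    rw [Polynomial.coe_add, Polynomial.coe_mul, Polynomial.coe_C, Polynomial.coe_C, Polynomial.coe_X]
  have hs_eq : s = q * π + (PowerSeries.C (r.coeff 1) * PowerSeries.X + PowerSeries.C (r.coeff 0)) := by
    rw [← hrcoe, mul_comm q π]; exact hdiv
  -- multiplication maps on `X` and their base changes to `V = ℚ₂ ⊗ X`
  let L : IwasawaAlgebra 2 → Module.End ℤ_[2] M := fun a ↦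
    (DistribSMul.toLinearMap (IwasawaAlgebra 2) M a).restrictScalars ℤ_[2]
  have hLmul : ∀ a b : IwasawaAlgebra 2, L (a * b) = L a * L b := fun a b ↦ by
    ext x
    change (a * b) • x = a • b • x
    rw [mul_smul]
  have hLadd : ∀ a b : IwasawaAlgebra 2, L (a + b) = L a + L b := fun a b ↦ by
    ext x
    change (a + b) • x = a • x + b • x
    rw [add_smul]
  have hLC : ∀ a : ℤ_[2], L (PowerSeries.C a) = algebraMap ℤ_[2] (Module.End ℤ_[2] M) a := fun a ↦ by
    ext x
    rw [Module.algebraMap_end_apply]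
    change (PowerSeries.C a : IwasawaAlgebra 2) • x = (algebraMap ℤ_[2] (IwasawaAlgebra 2) a) • x
    rfl
  have hLs : L s = 0 := by
    ext x
    exact hsM x
  have hbcC : ∀ a : ℤ_[2], ∀ v : ℚ_[2] ⊗[ℤ_[2]] M,
      ((algebraMap ℤ_[2] (Module.End ℤ_[2] M) a).baseChange ℚ_[2]) v = (algebraMap ℤ_[2] ℚ_[2] a) • v := fun a v ↦ by
    rw [Algebra.algebraMap_eq_smul_one, LinearMap.baseChange_smul, LinearMap.baseChange_one, LinearMap.smul_apply,
      Module.End.one_apply, algebraMap_smul]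
  set A : Module.End ℚ_[2] (ℚ_[2] ⊗[ℤ_[2]] M) := (L PowerSeries.X).baseChange ℚ_[2] with hA
  set N : Module.End ℚ_[2] (ℚ_[2] ⊗[ℤ_[2]] M) := (L π).baseChange ℚ_[2] with hN
  have hNA : ∀ v, N v = A (A v) + (2 : ℚ_[2]) • A v + (2 : ℚ_[2]) • v := fun v ↦ by
    rw [hN, hπ, hLadd, hLadd, hLmul, hLmul, hLC, LinearMap.baseChange_add, LinearMap.baseChange_add,
      LinearMap.baseChange_mul, LinearMap.baseChange_mul, LinearMap.add_apply, LinearMap.add_apply, Module.End.mul_apply,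
      Module.End.mul_apply, hbcC, hbcC, map_ofNat]
  -- on `ker N`: `b • A v + a • v = 0`
  have hrel : ∀ v, N v = 0 →
      (algebraMap ℤ_[2] ℚ_[2] (r.coeff 1)) • A v + (algebraMap ℤ_[2] ℚ_[2] (r.coeff 0)) • v = 0 := by
    intro v hv
    have h1 : ((L s).baseChange ℚ_[2]) v = 0 := by rw [hLs, LinearMap.baseChange_zero, LinearMap.zero_apply]
    rw [hs_eq, hLadd, hLadd, hLmul, hLmul, hLC, hLC, LinearMap.baseChange_add, LinearMap.baseChange_add,
      LinearMap.baseChange_mul, LinearMap.baseChange_mul, LinearMap.add_apply, LinearMap.add_apply, Module.End.mul_apply,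
      Module.End.mul_apply, hbcC, hbcC] at h1
    change ((L q).baseChange ℚ_[2]) (N v) + _ = 0 at h1
    rwa [hv, map_zero, zero_add] at h1
  have h1 := LambdaTransportDoorAtTwoLayerOne.lambdaInvariant_quotient_eq_finrank_ker hM π
  rw [h1]
  refine Submodule.finrank_eq_zero.mpr (LinearMap.ker_eq_bot'.mpr fun v hv ↦ ?_)
  change N v = 0 at hv
  have hinj : Function.Injective (algebraMap ℤ_[2] ℚ_[2]) := IsFractionRing.injective ℤ_[2] ℚ_[2]
  have hv' := hrel v hv
  by_cases hb : r.coeff 1 = 0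
  · have ha : r.coeff 0 ≠ 0 := hab.resolve_left (not_not.mpr hb)
    rw [hb, map_zero, zero_smul, zero_add] at hv'
    exact (smul_eq_zero.mp hv').resolve_left ((map_ne_zero_iff _ hinj).mpr ha)
  · have hbQ : algebraMap ℤ_[2] ℚ_[2] (r.coeff 1) ≠ 0 := (map_ne_zero_iff _ hinj).mpr hb
    set c : ℚ_[2] := -(algebraMap ℤ_[2] ℚ_[2] (r.coeff 0)) / (algebraMap ℤ_[2] ℚ_[2] (r.coeff 1)) with hc
    have hAv : A v = c • v := by
      have h2 : (algebraMap ℤ_[2] ℚ_[2] (r.coeff 1)) • A v = -((algebraMap ℤ_[2] ℚ_[2] (r.coeff 0)) • v) :=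
        eq_neg_of_add_eq_zero_left hv'
      calc A v = (algebraMap ℤ_[2] ℚ_[2] (r.coeff 1))⁻¹ • ((algebraMap ℤ_[2] ℚ_[2] (r.coeff 1)) • A v) := by
            rw [smul_smul, inv_mul_cancel₀ hbQ, one_smul]
        _ = c • v := by rw [h2, smul_neg, smul_smul, ← neg_smul, hc, neg_div, div_eq_inv_mul]
    have hNv := hNA v
    rw [hv, hAv, map_smul, hAv, smul_smul, smul_smul, ← add_smul, ← add_smul] at hNv
    exact (smul_eq_zero.mp hNv.symm).resolve_left (padicTwo_nu_ne_zero c ∘ fun h ↦ by linear_combination h)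

/-- **`rank_{ℤ₂} X/ν₂X = 0 ⟺ ν₂ ∤ f_X`** for a f.g. torsion `Λ₂`-module `X` with `char X = (f_X)` (both directions of the local
criterion `ℓ_{(ν₂)}(X) = 0 ⟺ char X ⊄ (ν₂)`; `⟹` by `…ResidualShape`, `⟸` by the lemma above).
[cite: Washington1997, §13.2] [cite: BourbakiAC5to7, Ch. VII §4 no. 5] -/
theorem lambdaInvariant_quotient_nu_two_eq_zero_iff_not_dvd [Module.Finite (IwasawaAlgebra 2) M]
    (hM : Module.IsTorsion (IwasawaAlgebra 2) M) {f : IwasawaAlgebra 2}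
    (hchar : Module.charIdeal (IwasawaAlgebra 2) M = Ideal.span {f}) :
    lambdaInvariant 2 (M ⧸ (Ideal.span {(PowerSeries.X * PowerSeries.X + PowerSeries.C (2 : ℤ_[2]) * PowerSeries.X +
      PowerSeries.C (2 : ℤ_[2]) : IwasawaAlgebra 2)} • (⊤ : Submodule (IwasawaAlgebra 2) M))) = 0 ↔
      ¬ (PowerSeries.X * PowerSeries.X + PowerSeries.C (2 : ℤ_[2]) * PowerSeries.X + PowerSeries.C (2 : ℤ_[2]) :
        IwasawaAlgebra 2) ∣ f := by
  classical
  set π : IwasawaAlgebra 2 := PowerSeries.X * PowerSeries.X + PowerSeries.C (2 : ℤ_[2]) * PowerSeries.X +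
    PowerSeries.C (2 : ℤ_[2]) with hπ
  have hπp : Prime π := prime_nu_two
  let 𝔭 : PrimeSpectrum (IwasawaAlgebra 2) := ⟨Ideal.span {π}, (Ideal.span_singleton_prime hπp.ne_zero).mpr hπp⟩
  have h𝔭1 : 𝔭.asIdeal.height = 1 := Module.height_span_singleton_eq_one_of_prime hπp
  have key : Module.charIdeal (IwasawaAlgebra 2) M ≤ 𝔭.asIdeal ↔ π ∣ f := by
    change Module.charIdeal (IwasawaAlgebra 2) M ≤ Ideal.span _ ↔ _
    rw [hchar, Ideal.span_singleton_le_iff_mem, Ideal.mem_span_singleton]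
  constructor
  · intro h0 hdvd
    exact SignedBaseChangeAcDivSpecialization.LocalLength.lengthAt_ne_zero_of_charIdeal_le h𝔭1 (key.mpr hdvd)
      (LambdaTransportDoorAtTwoResidualShape.lengthAt_eq_zero_of_lambdaInvariant_quotient_eq_zero hM
        hπp (fun s hs ↦ C_notMem_span_nu_two hs) 𝔭 rfl h0)
  · intro hndvd
    refine lambdaInvariant_quotient_nu_two_eq_zero_of_lengthAt_eq_zero hM 𝔭 rfl ?_
    by_contra hne
    refine hndvd (key.mp ?_)
    obtain ⟨s, hs, hs0⟩ := Submodule.annihilator_top_inter_nonZeroDivisors hM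
    have hsM : Module.IsTorsionBy (IwasawaAlgebra 2) M s := fun x ↦
      Submodule.mem_annihilator.mp hs x Submodule.mem_top
    have htop := Module.lengthAt_ne_top_of_isTorsionBy (nonZeroDivisors.ne_zero hs0) hsM 𝔭 h𝔭1.le
    have hn : (Module.lengthAt (IwasawaAlgebra 2) M 𝔭).toNat ≠ 0 := by
      rw [Ne, ENat.toNat_eq_zero, not_or]; exact ⟨hne, htop⟩
    exact (Summit.BirchSwinnertonDyer.Rank1Residual.X11b.CongruenceLimit.charIdeal_le_pow_lengthAt hM 𝔭 h𝔭1).trans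
      (Ideal.pow_le_self hn)

end Module

end Summit.BirchSwinnertonDyer.BirchSwinnertonDyer.Theorems.LambdaTransportDoorAtTwoNuTwoCriterion
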